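import Mathlib.Data.Rat.Defs
import Mathlib.Data.Finset.Basic
import Mathlib.Algebra.BigOperators.Group.List.Basic
import Mathlib.Algebra.Order.Field.Basic
import Mathlib.Tactic.Linarith
import Mathlib.Tactic.NormNum
import Mathlib.Tactic.IntervalCases
import Mathlib.Tactic.Positivity
import Mathlib.Tactic.Ring
import Mathlib.Tactic.GCongr
import Mathlib.Tactic.LinearCombination
import HarnessLib

/-!
# The F-DENSE census for `p = 7` on the open interval `1/39 < ρ < 1/36` (T37)

Uniform value line: INSTRUMENT — kernel-checked WEIGHT ARITHMETIC for the polynomial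
weighted-centre model `W(f)` of the cell (engine 1's toy model: THEOREM-L5N-eng1-g36 §5.2 LEMMA
F-DENSE_ρ(7), census tool `fdense36.py` PARTS S/A/K/Z; CARVER-NOTES-eng1-g36 T37) — NOT a
resolution theorem, NOT a statement about the Abramovich–Temkin–Włodarczyk invariant, NOT summit
progress; AI-written Lean, AI review is weaker than expert review.

The degree `ρ = r` is SYMBOLIC: every statement carries the hypotheses `1/39 < r` and `r < 1/36`
and holds on the WHOLE open interval (the census tool samples the 13 cells cut out by the
breakpoints `7/270 < 5/192 < 1/38 < 19/720 < 7/264 < 2/75`; here the cells appear as the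
`r`-conditions of the individual facts).  Weights are genuine (not rescaled).

## Dictionary

* legal slot weights: `Legal w := (0 < w ∧ w ≤ 1/5) ∨ w ∈ U`, `U = {5/24, 2/9, 1/4, 1/3, 1/2}`
  (the classes `N, N', W, M, V`); "dense" = the first alternative.
* `u := 7r ∈ (7/39, 7/36)` is the (dense) weight of the pure `σ⁷`-class `F`; the `T`-variables
  are the slots of weight `≥ u`: `TWt r x := Dense r x ∨ x ∈ U`, `Dense r x := 7r ≤ x ≤ 1/5`
  (a CONTINUUM, handled symbolically as in the census tool's coding A).
* an impure SUPPLIER of order `s` (`1 ≤ s ≤ 7`) with output group `κ` (`≤ 2` `T`-parts, PART S)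
  sits in a slot of legal weight `wt κ + s r`; the unrectified pure class `a₁` has weight `4r`
  and order `4`.  An ACTIVE SET is a multiset of member kinds with orders summing to `7`, at least
  one impure member, whose kept weight `1 − Σ (member weights)` is `Representable` as a sum of
  `T`-weights.

## Content

* §0 interval facts: `u`-facts (`7r < 1/5 < 8r`, `7r ∉ U`, `49 r > 1`, five light cofactors),
  the legal pure degrees (`pureDegree_dense_iff`: `1 ≤ j ≤ 7`; `pureDegree_mem_U_iff`: `j = 8` at
  `r = 5/192`, `j = 19` at `r = 1/38`, nothing else), the sorted breakpoints.
* PART S (`onePart_census`, `legal_twoParts_iff`, `pairSum_census`, `not_legal_threeParts`,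
  `no_supplier_order_six_seven`) and the existence cells of the nine supplier shapes
  (`tWt_x1` … `exists_V5_iff`): `N'(1;x₁)`, `W(2;x₃)`, `V(2;W x₃)`, `V(4;x x')` always;
  `N(1;x₂)` iff `r ≤ 5/192`; `V(3;N' x₄)` iff `7/270 ≤ r`; `V(4;N x₅)` iff `r ≤ 7/264`;
  `V(5;x x')` iff `r ≤ 1/38`; `M(5;x₆)` iff `2/75 ≤ r`.
* PART A: the `93` candidate multisets (`candidates_length`), the `r`-free kept-weight table
  (`kept_table`) and the symbolic representability census `active_census`: exactly the ELEVEN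
  active sets of §5.2 / `fdense36.log` (`{N'(1;x₁), W(2;x₃), a₁}` only for `r ≥ 19/720`; the set
  `{N, N, M(5;·)}` keeps `1/4` but its members never coexist), and `factA`: each contains a killed
  kind (`W(2;x₃)`, its companion `V(2;W x₃)`, `N'(1;x₁)` or `V(3;N' x₄)`).
* PART K: the block-legality arithmetic of the kill readings (`W2_blocks` for `μ = VW` and
  `WWW`, `Np1_blocks`, `V3_blocks`, and `N1_blocks` for information): a block carried by one
  emitter is legal only as MAIN or COMPANION, and the named side facts `kill_side_facts` of
  CARVER-NOTES T37 (iii).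
* PART Z: `49 r > 1` and no supplier of order `7` (`u_facts`, `no_supplier_order_six_seven`).

Not here: the coefficient identities of the kill readings themselves (LEMMA CS, `N_W`, LEMMA N,
`N_{N'}` — see the companion identity files) and the emission rules (which `κ` a slot class can
emit), taken as the definition of "supplier" as in the census tool.

References (context only; elementary arithmetic decided here): [AbramovichTemkinWlodarczyk2024] §5
(weights of a weighted centre); [Wlodarczyk2022] (weighted centres in arbitrary characteristic).
-/

namespace Literature.AlgebraicGeometry.Resolution.WeightedBlowup

namespace Interval39

/-! ## Legal weights and `T`-weights -/

/-- `U = {5/24, 2/9, 1/4, 1/3, 1/2}` (the classes `N, N', W, M, V`, LEMMA G).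
[cite: AbramovichTemkinWlodarczyk2024, §5] -/
def U : Finset ℚ := {5/24, 2/9, 1/4, 1/3, 1/2}

/-- Legal slot weight: dense `(0, 1/5]` or in `U`. [cite: AbramovichTemkinWlodarczyk2024, §5] -/
def Legal (w : ℚ) : Prop := (0 < w ∧ w ≤ 1/5) ∨ w ∈ U

/-- `Legal` is decidable. [folklore] instance plumbing; context
[cite: AbramovichTemkinWlodarczyk2024, §5]. -/
instance instDecidablePredLegal : DecidablePred Legal :=
  fun _ => inferInstanceAs (Decidable ((_ ∧ _) ∨ _))

/-- Dense `T`-weight at degree `r`: `7r ≤ x ≤ 1/5` (weight at least `u = 7r`, the pure class `F`).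
[cite: AbramovichTemkinWlodarczyk2024, §5] -/
def Dense (r x : ℚ) : Prop := 7 * r ≤ x ∧ x ≤ 1/5

/-- Weight of a `T`-variable at degree `r`: dense in `[7r, 1/5]` or in `U`.
[cite: AbramovichTemkinWlodarczyk2024, §5] -/
def TWt (r x : ℚ) : Prop := Dense r x ∨ x ∈ U

/-- Membership in `U`, unfolded. [cite: AbramovichTemkinWlodarczyk2024, §5] -/
theorem mem_U {w : ℚ} : w ∈ U ↔ w = 5/24 ∨ w = 2/9 ∨ w = 1/4 ∨ w = 1/3 ∨ w = 1/2 := by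
  simp [U]

/-- A `T`-weight is dense or one of the five `U`-values (case split used throughout).
[cite: AbramovichTemkinWlodarczyk2024, §5] -/
theorem tWt_cases {r x : ℚ} (hx : TWt r x) :
    Dense r x ∨ x = 5/24 ∨ x = 2/9 ∨ x = 1/4 ∨ x = 1/3 ∨ x = 1/2 := by
  rcases hx with h | h
  · exact Or.inl h
  · exact Or.inr (mem_U.mp h)

/-- Every `T`-weight is `≥ 7r` (the `U`-values are `≥ 5/24 > 7/36 > 7r`).
[cite: AbramovichTemkinWlodarczyk2024, §5] -/
theorem seven_mul_le_of_tWt {r x : ℚ} (h2 : r < 1/36) (hx : TWt r x) : 7 * r ≤ x := by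
  rcases tWt_cases hx with ⟨h, -⟩ | h | h | h | h | h <;> linarith

/-- Every `T`-weight is `≤ 1/2`. [cite: AbramovichTemkinWlodarczyk2024, §5] -/
theorem le_half_of_tWt {r x : ℚ} (hx : TWt r x) : x ≤ 1/2 := by
  rcases tWt_cases hx with ⟨-, h⟩ | h | h | h | h | h <;> linarith

/-- A legal weight is `≤ 1/2`. [cite: AbramovichTemkinWlodarczyk2024, §5] -/
theorem le_half_of_legal {w : ℚ} (h : Legal w) : w ≤ 1/2 := by
  rcases h with ⟨-, h⟩ | h
  · linarith
  · rcases mem_U.mp h with h | h | h | h | h <;> linarith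

/-- Above the dense range, legal means `∈ U`. [cite: AbramovichTemkinWlodarczyk2024, §5] -/
theorem legal_iff_mem_U_of_lt {w : ℚ} (h : 1/5 < w) : Legal w ↔ w ∈ U := by
  constructor
  · rintro (⟨-, h'⟩ | h')
    · exfalso; linarith
    · exact h'
  · exact Or.inr

/-- Above `1/3`, the only legal weight is `1/2` (`V`). [cite: AbramovichTemkinWlodarczyk2024, §5] -/
theorem legal_iff_eq_half_of_lt {w : ℚ} (h : 1/3 < w) : Legal w ↔ w = 1/2 := by
  rw [legal_iff_mem_U_of_lt (by linarith), mem_U]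
  constructor
  · rintro (h' | h' | h' | h' | h') <;> linarith
  · intro h'; exact Or.inr (Or.inr (Or.inr (Or.inr h')))

/-! ## §0 Interval facts: `u = 7r`, the legal pure degrees, the breakpoints -/

/-- **`u`-facts.** On `1/39 < r < 1/36`: `u = 7r` lies in `(4r, 1/5)`, is dense and not in
`U`; `8r > 1/5` (a supplier slot `wt κ + s r ≥ 8r` is never dense); `14r > 1/3`, `21r > 1/2`
(two `T`-parts force a `V`-slot, three are impossible); `49r > 1` (PART Z: a monomial with
`ε_{f₀}⁷` has value `> 1`); and `15r < 1 − 21r < 18r` (the first class `3r` has exactly five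
light cofactors). [cite: AbramovichTemkinWlodarczyk2024, §5] -/
theorem u_facts {r : ℚ} (h1 : 1/39 < r) (h2 : r < 1/36) :
    4 * r < 7 * r ∧ 7 * r < 1/5 ∧ 1/5 < 8 * r ∧ 7 * r ∉ U ∧ TWt r (7 * r) ∧ 1/3 < 14 * r ∧
      1/2 < 21 * r ∧ 1 < 49 * r ∧ 15 * r < 1 - 21 * r ∧ 1 - 21 * r < 18 * r := by
  refine ⟨by linarith, by linarith, by linarith, ?_, Or.inl ⟨le_rfl, by linarith⟩, by linarith,
    by linarith, by linarith, by linarith, by linarith⟩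
  rw [mem_U]; rintro (h | h | h | h | h) <;> linarith

/-- Bounds for a pure degree hitting a given weight: `j r = u > 0` forces `36u < j < 39u`.
[cite: AbramovichTemkinWlodarczyk2024, §5] -/
theorem pureDegree_bounds {r u : ℚ} {j : ℕ} (h1 : 1/39 < r) (h2 : r < 1/36) (hu : 0 < u)
    (h : (j : ℚ) * r = u) : 36 * u < j ∧ (j : ℚ) < 39 * u := by
  have hj : (0 : ℚ) < j := by
    rcases Nat.eq_zero_or_pos j with rfl | hj
    · simp at h; linarith
    · exact_mod_cast hj
  have p1 := mul_pos hj (show (0 : ℚ) < 1/36 - r by linarith)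
  have p2 := mul_pos hj (show (0 : ℚ) < r - 1/39 by linarith)
  constructor
  · nlinarith [p1]
  · nlinarith [p2]

/-- **Legal pure degrees, dense part.** `j r` is a dense legal weight iff `1 ≤ j ≤ 7`
(`7r < 7/36 < 1/5 < 8/39 < 8r`). [cite: AbramovichTemkinWlodarczyk2024, §5] -/
theorem pureDegree_dense_iff {r : ℚ} (h1 : 1/39 < r) (h2 : r < 1/36) (j : ℕ) :
    (0 < (j : ℚ) * r ∧ (j : ℚ) * r ≤ 1/5) ↔ 1 ≤ j ∧ j ≤ 7 := by
  have hr : 0 < r := by linarith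
  constructor
  · rintro ⟨hpos, hle⟩
    constructor
    · rcases Nat.eq_zero_or_pos j with rfl | hj
      · simp at hpos
      · exact hj
    · rcases le_or_gt j 7 with hj | hj
      · exact hj
      · exfalso
        have h8 : (8 : ℚ) ≤ j := by exact_mod_cast (show 8 ≤ j by omega)
        have : 8 * r ≤ (j : ℚ) * r := mul_le_mul_of_nonneg_right h8 hr.le
        linarith
  · rintro ⟨hj1, hj7⟩
    have hj1' : (1 : ℚ) ≤ j := by exact_mod_cast hj1
    have hj7' : (j : ℚ) ≤ 7 := by exact_mod_cast hj7
    constructor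
    · exact mul_pos (by linarith) hr
    · have : (j : ℚ) * r ≤ 7 * r := mul_le_mul_of_nonneg_right hj7' hr.le
      linarith

/-- **Legal pure degrees, `U`-part.** `j r ∈ U` iff `(j, r) = (8, 5/192)` (`8r = 5/24 = N`) or
`(19, 1/38)` (`19r = 1/2 = V`); the windows `36u < j < 39u` for `u = 2/9, 1/4, 1/3` contain no
integer. [cite: AbramovichTemkinWlodarczyk2024, §5] -/
theorem pureDegree_mem_U_iff {r : ℚ} (h1 : 1/39 < r) (h2 : r < 1/36) (j : ℕ) :
    (j : ℚ) * r ∈ U ↔ (j = 8 ∧ r = 5/192) ∨ (j = 19 ∧ r = 1/38) := by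
  rw [mem_U]
  constructor
  · rintro (h | h | h | h | h) <;> obtain ⟨ha, hb⟩ := pureDegree_bounds h1 h2 (by norm_num) h
    · have hj1 : 7 < j := by exact_mod_cast (show (7 : ℚ) < j by linarith)
      have hj2 : j < 9 := by exact_mod_cast (show (j : ℚ) < 9 by linarith)
      obtain rfl : j = 8 := by omega
      left; exact ⟨rfl, by push_cast at h; linarith⟩
    · have hj1 : 8 < j := by exact_mod_cast (show (8 : ℚ) < j by linarith)
      have hj2 : j < 9 := by exact_mod_cast (show (j : ℚ) < 9 by linarith)
      omega
    · have hj1 : 9 < j := by exact_mod_cast (show (9 : ℚ) < j by linarith)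
      have hj2 : j < 10 := by exact_mod_cast (show (j : ℚ) < 10 by linarith)
      omega
    · have hj1 : 12 < j := by exact_mod_cast (show (12 : ℚ) < j by linarith)
      have hj2 : j < 13 := by exact_mod_cast (show (j : ℚ) < 13 by linarith)
      omega
    · have hj1 : 18 < j := by exact_mod_cast (show (18 : ℚ) < j by linarith)
      have hj2 : j < 20 := by exact_mod_cast (show (j : ℚ) < 20 by linarith)
      obtain rfl : j = 19 := by omega
      right; exact ⟨rfl, by push_cast at h; linarith⟩
  · rintro (⟨rfl, rfl⟩ | ⟨rfl, rfl⟩) <;> norm_num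

/-- **Legal pure degrees, summary.** `j r` is legal iff `1 ≤ j ≤ 7`, or `(j, r) = (8, 5/192)`,
or `(j, r) = (19, 1/38)`. [cite: AbramovichTemkinWlodarczyk2024, §5] -/
theorem pureDegree_legal_iff {r : ℚ} (h1 : 1/39 < r) (h2 : r < 1/36) (j : ℕ) :
    Legal ((j : ℚ) * r) ↔ (1 ≤ j ∧ j ≤ 7) ∨ (j = 8 ∧ r = 5/192) ∨ (j = 19 ∧ r = 1/38) := by
  unfold Legal
  rw [pureDegree_dense_iff h1 h2, pureDegree_mem_U_iff h1 h2]

/-- **The breakpoints are sorted** inside the interval: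
`1/39 < 7/270 < 5/192 < 1/38 < 19/720 < 7/264 < 2/75 < 1/36` (so `13` cells).
[cite: AbramovichTemkinWlodarczyk2024, §5] -/
theorem breakpoints_sorted :
    (1/39 : ℚ) < 7/270 ∧ (7/270 : ℚ) < 5/192 ∧ (5/192 : ℚ) < 1/38 ∧ (1/38 : ℚ) < 19/720 ∧
      (19/720 : ℚ) < 7/264 ∧ (7/264 : ℚ) < 2/75 ∧ (2/75 : ℚ) < 1/36 := by
  norm_num

/-! ## PART S: the supplier census -/

set_option maxHeartbeats 800000 in
/-- **One `T`-part** (`κ = x`, orders `s = 1, …, 7`).  For a `T`-weight `x`, `x + s r` is legal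
iff `(s, x) ∈ {(1, 2/9 − r), (1, 5/24 − r), (2, 1/4 − 2r), (5, 1/3 − 5r)}` — the shapes
`N'(1;x₁)`, `N(1;x₂)`, `W(2;x₃)`, `M(5;x₆)`; orders `3, 4, 6, 7` have none.  (Whether the named
`x` IS a `T`-weight depends on `r`: see `tWt_x1` … `tWt_x6_iff`.)
[cite: AbramovichTemkinWlodarczyk2024, §5] -/
theorem onePart_census {r : ℚ} (h1 : 1/39 < r) (h2 : r < 1/36) (x : ℚ) (hx : TWt r x) :
    (Legal (x + r) ↔ x = 2/9 - r ∨ x = 5/24 - r) ∧ (Legal (x + 2 * r) ↔ x = 1/4 - 2 * r) ∧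
      ¬ Legal (x + 3 * r) ∧ ¬ Legal (x + 4 * r) ∧ (Legal (x + 5 * r) ↔ x = 1/3 - 5 * r) ∧
      ¬ Legal (x + 6 * r) ∧ ¬ Legal (x + 7 * r) := by
  have h7 := seven_mul_le_of_tWt h2 hx
  rw [legal_iff_mem_U_of_lt (by linarith), legal_iff_mem_U_of_lt (by linarith),
    legal_iff_mem_U_of_lt (by linarith), legal_iff_mem_U_of_lt (by linarith),
    legal_iff_mem_U_of_lt (by linarith), legal_iff_mem_U_of_lt (by linarith),
    legal_iff_mem_U_of_lt (by linarith), mem_U, mem_U, mem_U, mem_U, mem_U, mem_U, mem_U]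
  rcases tWt_cases hx with ⟨hd1, hd2⟩ | rfl | rfl | rfl | rfl | rfl
  · refine ⟨⟨?_, ?_⟩, ⟨?_, ?_⟩, ?_, ?_, ⟨?_, ?_⟩, ?_, ?_⟩
    · rintro (h' | h' | h' | h' | h')
      · exact Or.inr (by linarith)
      · exact Or.inl (by linarith)
      all_goals exfalso; linarith
    · rintro (rfl | rfl)
      · exact Or.inr (Or.inl (by ring))
      · exact Or.inl (by ring)
    · rintro (h' | h' | h' | h' | h')
      any_goals exfalso; linarith
      linarith
    · rintro rfl; exact Or.inr (Or.inr (Or.inl (by ring)))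
    · rintro (h' | h' | h' | h' | h') <;> linarith
    · rintro (h' | h' | h' | h' | h') <;> linarith
    · rintro (h' | h' | h' | h' | h')
      any_goals exfalso; linarith
      linarith
    · rintro rfl; exact Or.inr (Or.inr (Or.inr (Or.inl (by ring))))
    · rintro (h' | h' | h' | h' | h') <;> linarith
    · rintro (h' | h' | h' | h' | h') <;> linarith
  -- `x ∈ U`: every alternative is contradictory (closed arithmetic in `r`)
  all_goals
    refine ⟨⟨?_, ?_⟩, ⟨?_, ?_⟩, ?_, ?_, ⟨?_, ?_⟩, ?_, ?_⟩
    · rintro (h' | h' | h' | h' | h') <;> linarith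
    · rintro (h' | h') <;> linarith
    · rintro (h' | h' | h' | h' | h') <;> linarith
    · intro h'; linarith
    · rintro (h' | h' | h' | h' | h') <;> linarith
    · rintro (h' | h' | h' | h' | h') <;> linarith
    · rintro (h' | h' | h' | h' | h') <;> linarith
    · intro h'; linarith
    · rintro (h' | h' | h' | h' | h') <;> linarith
    · rintro (h' | h' | h' | h' | h') <;> linarith

/-- **Two `T`-parts: the slot is `V`.** For `T`-weights `x, y` and `s ≥ 0`, `x + y + s` is legal
iff it equals `1/2` (`x + y ≥ 14r > 1/3`). [cite: AbramovichTemkinWlodarczyk2024, §5] -/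
theorem legal_twoParts_iff {r : ℚ} (h1 : 1/39 < r) (h2 : r < 1/36) (x y s : ℚ) (hx : TWt r x)
    (hy : TWt r y) (hs : 0 ≤ s) : Legal (x + y + s) ↔ x + y + s = 1/2 :=
  legal_iff_eq_half_of_lt
    (by linarith [seven_mul_le_of_tWt h2 hx, seven_mul_le_of_tWt h2 hy])

set_option maxHeartbeats 800000 in
/-- **Two `T`-parts: the pair sums.** For `T`-weights `x ≤ y` and `s = 1, …, 7`, `x + y = 1/2 − s r`
happens exactly for: `s = 2`, `(x, y) = (1/4 − 2r, 1/4)` (`V(2;W x₃)`); `s = 3`,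
`(x, y) = (5/18 − 3r, 2/9)` (`V(3;N' x₄)`); `s = 4`, both dense (`V(4;x x')`) or
`(x, y) = (7/24 − 4r, 5/24)` (`V(4;N x₅)`); `s = 5`, both dense (`V(5;x x')`); never for
`s = 1, 6, 7`. [cite: AbramovichTemkinWlodarczyk2024, §5] -/
theorem pairSum_census {r : ℚ} (h1 : 1/39 < r) (h2 : r < 1/36) (x y : ℚ) (hx : TWt r x)
    (hy : TWt r y) (hxy : x ≤ y) :
    ¬ (x + y = 1/2 - r) ∧ (x + y = 1/2 - 2 * r ↔ x = 1/4 - 2 * r ∧ y = 1/4) ∧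
      (x + y = 1/2 - 3 * r ↔ x = 5/18 - 3 * r ∧ y = 2/9) ∧
      (x + y = 1/2 - 4 * r ↔
        (Dense r x ∧ Dense r y ∧ x + y = 1/2 - 4 * r) ∨ (x = 7/24 - 4 * r ∧ y = 5/24)) ∧
      (x + y = 1/2 - 5 * r ↔ Dense r x ∧ Dense r y ∧ x + y = 1/2 - 5 * r) ∧
      ¬ (x + y = 1/2 - 6 * r) ∧ ¬ (x + y = 1/2 - 7 * r) := by
  have hx7 := seven_mul_le_of_tWt h2 hx
  have hy7 := seven_mul_le_of_tWt h2 hy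
  rcases tWt_cases hx with ⟨hxd1, hxd2⟩ | rfl | rfl | rfl | rfl | rfl <;>
    rcases tWt_cases hy with ⟨hyd1, hyd2⟩ | rfl | rfl | rfl | rfl | rfl
  -- `x`, `y` both dense
  · refine ⟨by intro h; linarith, ⟨fun h => by exfalso; linarith, fun ⟨_, h⟩ => by linarith⟩,
      ⟨fun h => by exfalso; linarith, fun ⟨_, h⟩ => by linarith⟩,
      ⟨fun h => Or.inl ⟨⟨hxd1, hxd2⟩, ⟨hyd1, hyd2⟩, h⟩, ?_⟩,
      ⟨fun h => ⟨⟨hxd1, hxd2⟩, ⟨hyd1, hyd2⟩, h⟩, fun ⟨_, _, h⟩ => h⟩, by intro h; linarith,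
      by intro h; linarith⟩
    rintro (⟨-, -, h⟩ | ⟨h, h'⟩) <;> linarith
  -- `x` dense, `y = 5/24`
  · refine ⟨by intro h; linarith, ⟨fun h => by exfalso; linarith, fun ⟨_, h⟩ => by linarith⟩,
      ⟨fun h => by exfalso; linarith, fun ⟨_, h⟩ => by linarith⟩,
      ⟨fun h => Or.inr ⟨by linarith, rfl⟩, ?_⟩,
      ⟨fun h => by exfalso; linarith, fun ⟨_, ⟨_, h⟩, _⟩ => by exfalso; linarith⟩,
      by intro h; linarith, by intro h; linarith⟩
    rintro (⟨-, ⟨-, h⟩, -⟩ | ⟨h, -⟩)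
    · exfalso; linarith
    · linarith
  -- `x` dense, `y = 2/9`
  · refine ⟨by intro h; linarith, ⟨fun h => by exfalso; linarith, fun ⟨_, h⟩ => by linarith⟩,
      ⟨fun h => ⟨by linarith, rfl⟩, fun ⟨h, _⟩ => by linarith⟩,
      ⟨fun h => by exfalso; linarith, ?_⟩,
      ⟨fun h => by exfalso; linarith, fun ⟨_, ⟨_, h⟩, _⟩ => by exfalso; linarith⟩,
      by intro h; linarith, by intro h; linarith⟩
    rintro (⟨-, ⟨-, h⟩, -⟩ | ⟨-, h⟩)
    · exfalso; linarith
    · exfalso; linarith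
  -- `x` dense, `y = 1/4`
  · refine ⟨by intro h; linarith, ⟨fun h => ⟨by linarith, rfl⟩, fun ⟨h, _⟩ => by linarith⟩,
      ⟨fun h => by exfalso; linarith, fun ⟨_, h⟩ => by linarith⟩,
      ⟨fun h => by exfalso; linarith, ?_⟩,
      ⟨fun h => by exfalso; linarith, fun ⟨_, ⟨_, h⟩, _⟩ => by exfalso; linarith⟩,
      by intro h; linarith, by intro h; linarith⟩
    rintro (⟨-, ⟨-, h⟩, -⟩ | ⟨-, h⟩)
    · exfalso; linarith
    · exfalso; linarith
  -- `x` dense, `y = 1/3`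
  · refine ⟨by intro h; linarith, ⟨fun h => by exfalso; linarith, fun ⟨_, h⟩ => by linarith⟩,
      ⟨fun h => by exfalso; linarith, fun ⟨_, h⟩ => by linarith⟩,
      ⟨fun h => by exfalso; linarith, ?_⟩,
      ⟨fun h => by exfalso; linarith, fun ⟨_, ⟨_, h⟩, _⟩ => by exfalso; linarith⟩,
      by intro h; linarith, by intro h; linarith⟩
    rintro (⟨-, ⟨-, h⟩, -⟩ | ⟨-, h⟩)
    · exfalso; linarith
    · exfalso; linarith
  -- `x` dense, `y = 1/2`
  · refine ⟨by intro h; linarith, ⟨fun h => by exfalso; linarith, fun ⟨_, h⟩ => by linarith⟩,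
      ⟨fun h => by exfalso; linarith, fun ⟨_, h⟩ => by linarith⟩,
      ⟨fun h => by exfalso; linarith, ?_⟩,
      ⟨fun h => by exfalso; linarith, fun ⟨_, ⟨_, h⟩, _⟩ => by exfalso; linarith⟩,
      by intro h; linarith, by intro h; linarith⟩
    rintro (⟨-, ⟨-, h⟩, -⟩ | ⟨-, h⟩)
    · exfalso; linarith
    · exfalso; linarith
  -- `x ∈ U`, `y` dense: impossible since `y ≤ 1/5 < x ≤ y`
  any_goals exfalso; linarith
  -- `x ∈ U`, `y ∈ U`: closed arithmetic in `r`
  all_goals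
    refine ⟨by intro h; linarith, ⟨fun h => by exfalso; linarith, fun ⟨h, _⟩ => by linarith⟩,
      ⟨fun h => by exfalso; linarith, fun ⟨h, _⟩ => by linarith⟩,
      ⟨fun h => by exfalso; linarith, ?_⟩,
      ⟨fun h => by exfalso; linarith, fun ⟨⟨_, h⟩, _, _⟩ => by exfalso; linarith⟩,
      by intro h; linarith, by intro h; linarith⟩
    rintro (⟨⟨-, h⟩, -, -⟩ | ⟨h, h'⟩)
    · exfalso; linarith
    · exfalso; linarith

/-- **Three `T`-parts: none.** `x + y + z + s ≥ 21r > 1/2` is never legal (`s ≥ 0`).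
[cite: AbramovichTemkinWlodarczyk2024, §5] -/
theorem not_legal_threeParts {r : ℚ} (h1 : 1/39 < r) (h2 : r < 1/36) (x y z s : ℚ)
    (hx : TWt r x) (hy : TWt r y) (hz : TWt r z) (hs : 0 ≤ s) : ¬ Legal (x + y + z + s) := by
  have := seven_mul_le_of_tWt h2 hx; have := seven_mul_le_of_tWt h2 hy
  have := seven_mul_le_of_tWt h2 hz
  intro h
  have := le_half_of_legal h
  linarith

/-- **No supplier of order `6` or `7`** (one or two parts; three never) — in particular no
single impure member of order `7` (PART Z). [cite: AbramovichTemkinWlodarczyk2024, §5] -/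
theorem no_supplier_order_six_seven {r : ℚ} (h1 : 1/39 < r) (h2 : r < 1/36) (x y : ℚ)
    (hx : TWt r x) (hy : TWt r y) :
    ¬ Legal (x + 6 * r) ∧ ¬ Legal (x + 7 * r) ∧ ¬ Legal (x + y + 6 * r) ∧
      ¬ Legal (x + y + 7 * r) := by
  have hc := onePart_census h1 h2 x hx
  refine ⟨hc.2.2.2.2.2.1, hc.2.2.2.2.2.2, ?_, ?_⟩
  · rw [legal_twoParts_iff h1 h2 x y (6 * r) hx hy (by linarith)]
    rcases le_total x y with hxy | hxy
    · intro h; exact (pairSum_census h1 h2 x y hx hy hxy).2.2.2.2.2.1 (by linarith)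
    · intro h; exact (pairSum_census h1 h2 y x hy hx hxy).2.2.2.2.2.1 (by linarith)
  · rw [legal_twoParts_iff h1 h2 x y (7 * r) hx hy (by linarith)]
    rcases le_total x y with hxy | hxy
    · intro h; exact (pairSum_census h1 h2 x y hx hy hxy).2.2.2.2.2.2 (by linarith)
    · intro h; exact (pairSum_census h1 h2 y x hy hx hxy).2.2.2.2.2.2 (by linarith)

/-! ### The existence cells of the supplier shapes -/

/-- `x₁ = 2/9 − r` (output of `N'(1;x₁)`) is a dense `T`-weight on the whole interval.
[cite: AbramovichTemkinWlodarczyk2024, §5] -/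
theorem tWt_x1 {r : ℚ} (h1 : 1/39 < r) (h2 : r < 1/36) : TWt r (2/9 - r) :=
  Or.inl ⟨by linarith, by linarith⟩

/-- `x₃ = 1/4 − 2r` (output of `W(2;x₃)`, half of `V(4;x₃ x₃)`, and with `W` the output of
`V(2;W x₃)`) is a dense `T`-weight on the whole interval. [cite: AbramovichTemkinWlodarczyk2024, §5] -/
theorem tWt_x3 {r : ℚ} (h1 : 1/39 < r) (h2 : r < 1/36) : TWt r (1/4 - 2 * r) :=
  Or.inl ⟨by linarith, by linarith⟩

/-- `x₂ = 5/24 − r` (output of `N(1;x₂)`) is a `T`-weight iff `r ≤ 5/192`.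
[cite: AbramovichTemkinWlodarczyk2024, §5] -/
theorem tWt_x2_iff {r : ℚ} (h1 : 1/39 < r) (h2 : r < 1/36) : TWt r (5/24 - r) ↔ r ≤ 5/192 := by
  constructor
  · intro h
    rcases tWt_cases h with ⟨h, -⟩ | h | h | h | h | h <;> linarith
  · intro h; exact Or.inl ⟨by linarith, by linarith⟩

/-- `x₄ = 5/18 − 3r` (with `N'` the output of `V(3;N' x₄)`) is a `T`-weight iff `7/270 ≤ r`.
[cite: AbramovichTemkinWlodarczyk2024, §5] -/
theorem tWt_x4_iff {r : ℚ} (h1 : 1/39 < r) (h2 : r < 1/36) :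
    TWt r (5/18 - 3 * r) ↔ 7/270 ≤ r := by
  constructor
  · intro h
    rcases tWt_cases h with ⟨-, h⟩ | h | h | h | h | h <;> linarith
  · intro h; exact Or.inl ⟨by linarith, by linarith⟩

/-- `x₅ = 7/24 − 4r` (with `N` the output of `V(4;N x₅)`) is a `T`-weight iff `r ≤ 7/264`.
[cite: AbramovichTemkinWlodarczyk2024, §5] -/
theorem tWt_x5_iff {r : ℚ} (h1 : 1/39 < r) (h2 : r < 1/36) :
    TWt r (7/24 - 4 * r) ↔ r ≤ 7/264 := by
  constructor
  · intro h
    rcases tWt_cases h with ⟨h, -⟩ | h | h | h | h | h <;> linarith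
  · intro h; exact Or.inl ⟨by linarith, by linarith⟩

/-- `x₆ = 1/3 − 5r` (output of `M(5;x₆)`) is a `T`-weight iff `2/75 ≤ r` (at `r = 1/40 < 1/39`
it would be `N`). [cite: AbramovichTemkinWlodarczyk2024, §5] -/
theorem tWt_x6_iff {r : ℚ} (h1 : 1/39 < r) (h2 : r < 1/36) :
    TWt r (1/3 - 5 * r) ↔ 2/75 ≤ r := by
  constructor
  · intro h
    rcases tWt_cases h with ⟨-, h⟩ | h | h | h | h | h <;> linarith
  · intro h; exact Or.inl ⟨by linarith, by linarith⟩

/-- `V(4;x x')` exists on the whole interval: `x = x' = 1/4 − 2r` are dense with sum `1/2 − 4r`.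
[cite: AbramovichTemkinWlodarczyk2024, §5] -/
theorem exists_V4 {r : ℚ} (h1 : 1/39 < r) (h2 : r < 1/36) :
    ∃ x y, Dense r x ∧ Dense r y ∧ x + y = 1/2 - 4 * r :=
  ⟨1/4 - 2 * r, 1/4 - 2 * r, ⟨by linarith, by linarith⟩, ⟨by linarith, by linarith⟩, by ring⟩

/-- `V(5;x x')` exists iff `r ≤ 1/38` (two dense weights sum to at most `2/5`).
[cite: AbramovichTemkinWlodarczyk2024, §5] -/
theorem exists_V5_iff {r : ℚ} (h1 : 1/39 < r) :
    (∃ x y, Dense r x ∧ Dense r y ∧ x + y = 1/2 - 5 * r) ↔ r ≤ 1/38 := by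
  constructor
  · rintro ⟨x, y, ⟨hx, -⟩, ⟨hy, -⟩, h⟩; linarith
  · intro h
    exact ⟨1/4 - 5/2 * r, 1/4 - 5/2 * r, ⟨by linarith, by linarith⟩, ⟨by linarith, by linarith⟩,
      by ring⟩

/-- The kept dense weight `11/36 − 4r` of the active set `{N'(1;x₁), W(2;x₃), a₁}·N'x` is a
`T`-weight iff `19/720 ≤ r`. [cite: AbramovichTemkinWlodarczyk2024, §5] -/
theorem tWt_keptNpW_iff {r : ℚ} (h1 : 1/39 < r) (h2 : r < 1/36) :
    TWt r (11/36 - 4 * r) ↔ 19/720 ≤ r := by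
  constructor
  · intro h
    rcases tWt_cases h with ⟨-, h⟩ | h | h | h | h | h <;> linarith
  · intro h; exact Or.inl ⟨by linarith, by linarith⟩

/-! ## PART A: candidates, kept weights, active sets -/

/-- `q` is representable by `T`-parts at degree `r`: the total weight of a (possibly empty)
list of `T`-variables. [cite: AbramovichTemkinWlodarczyk2024, §5] -/
def Representable (r q : ℚ) : Prop := ∃ l : List ℚ, (∀ x ∈ l, TWt r x) ∧ l.sum = q

/-- `0` is representable (empty product). [cite: AbramovichTemkinWlodarczyk2024, §5] -/
theorem repr_zero (r : ℚ) : Representable r 0 := ⟨[], by simp, rfl⟩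

/-- A `T`-weight is representable. [cite: AbramovichTemkinWlodarczyk2024, §5] -/
theorem repr_of_tWt {r q : ℚ} (h : TWt r q) : Representable r q :=
  ⟨[q], by simpa using h, by simp⟩

/-- Representable weights add. [cite: AbramovichTemkinWlodarczyk2024, §5] -/
theorem Representable.add {r a b : ℚ} (ha : Representable r a) (hb : Representable r b) :
    Representable r (a + b) := by
  obtain ⟨l, hl, rfl⟩ := ha
  obtain ⟨m, hm, rfl⟩ := hb
  refine ⟨l ++ m, fun x hx => ?_, by simp⟩
  rcases List.mem_append.mp hx with h | h
  · exact hl x h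
  · exact hm x h

/-- A list of `T`-weights has sum `≥ 7r · length`. [cite: AbramovichTemkinWlodarczyk2024, §5] -/
theorem sevenMul_length_le_sum {r : ℚ} (h2 : r < 1/36) (l : List ℚ) (hl : ∀ x ∈ l, TWt r x) :
    7 * r * (l.length : ℚ) ≤ l.sum := by
  induction l with
  | nil => simp
  | cons a l ih =>
    have ha := seven_mul_le_of_tWt h2 (hl a (by simp))
    have := ih fun x hx => hl x (by simp [hx])
    simp only [List.length_cons, Nat.cast_succ, List.sum_cons]
    linarith

/-- A negative weight is not representable. [cite: AbramovichTemkinWlodarczyk2024, §5] -/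
theorem not_repr_of_neg {r q : ℚ} (h1 : 1/39 < r) (h2 : r < 1/36) (h : q < 0) :
    ¬ Representable r q := by
  rintro ⟨l, hl, rfl⟩
  have h7 := sevenMul_length_le_sum h2 l hl
  have : (0 : ℚ) ≤ 7 * r * (l.length : ℚ) := mul_nonneg (by linarith) (by positivity)
  linarith

/-- A weight in `(0, 7r)` is not representable. [cite: AbramovichTemkinWlodarczyk2024, §5] -/
theorem not_repr_of_pos_of_lt {r q : ℚ} (h1 : 1/39 < r) (h2 : r < 1/36) (h0 : 0 < q)
    (h : q < 7 * r) : ¬ Representable r q := by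
  rintro ⟨l, hl, rfl⟩
  have h7 := sevenMul_length_le_sum h2 l hl
  cases l with
  | nil => simp at h0
  | cons a l =>
    have hlen : (1 : ℚ) ≤ ((a :: l).length : ℚ) := by simp
    have := mul_le_mul_of_nonneg_left hlen (show (0 : ℚ) ≤ 7 * r by linarith)
    linarith

/-- A weight in `(1/5, 14r)` outside `U` is not representable (one part would be the weight
itself; two parts weigh `≥ 14r`). [cite: AbramovichTemkinWlodarczyk2024, §5] -/
theorem not_repr_of_gap {r q : ℚ} (h1 : 1/39 < r) (h2 : r < 1/36) (h5 : 1/5 < q)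
    (h14 : q < 14 * r) (hU : q ∉ U) : ¬ Representable r q := by
  rintro ⟨l, hl, rfl⟩
  match l, hl with
  | [], _ => simp at h5; linarith
  | [a], hl =>
    have ha : TWt r a := hl a (by simp)
    simp only [List.sum_cons, List.sum_nil, add_zero] at h5 h14 hU
    rcases ha with ⟨-, h⟩ | h
    · linarith
    · exact hU h
  | a :: b :: l, hl =>
    have h7 := sevenMul_length_le_sum h2 (a :: b :: l) hl
    have hlen : (2 : ℚ) ≤ ((a :: b :: l).length : ℚ) := by
      have : 2 ≤ (a :: b :: l).length := by simp
      exact_mod_cast this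
    have := mul_le_mul_of_nonneg_left hlen (show (0 : ℚ) ≤ 7 * r by linarith)
    linarith

/-- Below `21r` a representable weight has at most two parts: it is `0`, a `T`-weight, or a sum
of two `T`-weights. [cite: AbramovichTemkinWlodarczyk2024, §5] -/
theorem repr_cases_of_lt {r q : ℚ} (h1 : 1/39 < r) (h2 : r < 1/36) (hq : q < 21 * r)
    (h : Representable r q) : q = 0 ∨ TWt r q ∨ ∃ a b, TWt r a ∧ TWt r b ∧ a + b = q := by
  obtain ⟨l, hl, rfl⟩ := h
  match l, hl with
  | [], _ => exact Or.inl rfl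
  | [a], hl => exact Or.inr (Or.inl (by simpa using hl a (by simp)))
  | [a, b], hl =>
    exact Or.inr (Or.inr ⟨a, b, hl a (by simp), hl b (by simp), by simp⟩)
  | a :: b :: c :: l, hl =>
    exfalso
    have h7 := sevenMul_length_le_sum h2 (a :: b :: c :: l) hl
    have hlen : (3 : ℚ) ≤ ((a :: b :: c :: l).length : ℚ) := by
      have : 3 ≤ (a :: b :: c :: l).length := by simp
      exact_mod_cast this
    have := mul_le_mul_of_nonneg_left hlen (show (0 : ℚ) ≤ 7 * r by linarith)
    linarith

/-- The member kinds of an active set on the interval: the nine supplier shapes of PART S and the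
unrectified pure class `a₁` (order `4`, weight `4r`).  (The two-dense-part shapes `V(4;x x')`,
`V(5;x x')` and the named-output shapes are distinguished because their existence cells differ;
the kept-weight arithmetic only sees slot weight and order.)
[cite: AbramovichTemkinWlodarczyk2024, §5] -/
inductive Kind
  /-- `N(1; x₂)`: slot `N = 5/24`, order `1`, output `x₂ = 5/24 − r`; exists iff `r ≤ 5/192` -/
  | N1
  /-- `N'(1; x₁)`: slot `N' = 2/9`, order `1`, output `x₁ = 2/9 − r` -/
  | Np1
  /-- `W(2; x₃)`: slot `W = 1/4`, order `2`, output `x₃ = 1/4 − 2r` -/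
  | W2
  /-- `V(2; W x₃)`: slot `V = 1/2`, order `2`, output `W · x₃` (the COMPANION of `W(2;x₃)`) -/
  | V2
  /-- `V(3; N' x₄)`: slot `V`, order `3`, output `N' · x₄`, `x₄ = 5/18 − 3r`; iff `7/270 ≤ r` -/
  | V3
  /-- `V(4; x x')`: slot `V`, order `4`, two dense outputs with `x + x' = 1/2 − 4r` -/
  | V4
  /-- `V(4; N x₅)`: slot `V`, order `4`, output `N · x₅`, `x₅ = 7/24 − 4r`; iff `r ≤ 7/264` -/
  | V4N
  /-- the unrectified pure class `a₁`: weight `4r`, order `4` (pure; configuration `{3,4,F}`) -/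
  | A1
  /-- `V(5; x x')`: slot `V`, order `5`, two dense outputs, `x + x' = 1/2 − 5r`; iff `r ≤ 1/38` -/
  | V5
  /-- `M(5; x₆)`: slot `M = 1/3`, order `5`, output `x₆ = 1/3 − 5r`; iff `2/75 ≤ r` -/
  | M5
  deriving DecidableEq

namespace Kind

/-- Constant part of the slot weight of a member kind (`a₁ ↦ 0`).
[cite: AbramovichTemkinWlodarczyk2024, §5] -/
def w0 : Kind → ℚ
  | N1 => 5/24 | Np1 => 2/9 | W2 => 1/4 | V2 => 1/2 | V3 => 1/2 | V4 => 1/2 | V4N => 1/2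
  | A1 => 0 | V5 => 1/2 | M5 => 1/3

/-- Coefficient of `r` in the slot weight of a member kind (`a₁ ↦ 4`, suppliers `↦ 0`).
[cite: AbramovichTemkinWlodarczyk2024, §5] -/
def w1 : Kind → ℚ
  | N1 => 0 | Np1 => 0 | W2 => 0 | V2 => 0 | V3 => 0 | V4 => 0 | V4N => 0 | A1 => 4 | V5 => 0
  | M5 => 0

/-- Slot weight of a member kind at degree `r`: `w0 + w1 · r` (`a₁` weighs `4r`).
[cite: AbramovichTemkinWlodarczyk2024, §5] -/
def wt (k : Kind) (r : ℚ) : ℚ := k.w0 + k.w1 * r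

/-- Order in `σ` of a member kind. [cite: AbramovichTemkinWlodarczyk2024, §5] -/
def s : Kind → ℕ
  | N1 => 1 | Np1 => 1 | W2 => 2 | V2 => 2 | V3 => 3 | V4 => 4 | V4N => 4 | A1 => 4 | V5 => 5
  | M5 => 5

/-- Impure (a supplier) or pure (`a₁`). [cite: AbramovichTemkinWlodarczyk2024, §5] -/
def impure : Kind → Bool
  | A1 => false | _ => true

/-- The KILLED kinds of §5.2 (kill order `W(2;x₃)` with its companion `V(2;W x₃)`, `N'(1;x₁)`,
`V(3;N' x₄)`). [cite: AbramovichTemkinWlodarczyk2024, §5] -/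
def killed : Kind → Bool
  | W2 => true | V2 => true | Np1 => true | V3 => true | _ => false

/-- Existence cell of a member kind (PART S: `tWt_x2_iff`, `tWt_x4_iff`, `tWt_x5_iff`,
`exists_V5_iff`, `tWt_x6_iff`; the others exist on the whole interval).
[cite: AbramovichTemkinWlodarczyk2024, §5] -/
def ExistsAt (k : Kind) (r : ℚ) : Prop := match k with
  | N1 => r ≤ 5/192 | V3 => 7/270 ≤ r | V4N => r ≤ 7/264 | V5 => r ≤ 1/38 | M5 => 2/75 ≤ r
  | _ => True

end Kind

/-- All ten kinds, in a fixed order. [cite: AbramovichTemkinWlodarczyk2024, §5] -/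
def allKinds : List Kind := [.N1, .Np1, .W2, .V2, .V3, .V4, .V4N, .A1, .V5, .M5]

/-- `allKinds` is exhaustive. [cite: AbramovichTemkinWlodarczyk2024, §5] -/
theorem mem_allKinds (k : Kind) : k ∈ allKinds := by cases k <;> decide

/-- **The kinds match PART S.** Each supplier kind's slot weight is `wt κ + s r` for its output
`κ` and order `s` (rows of `onePart_census` / `pairSum_census`), and its existence cell is the
`T`-weight condition on its output. [cite: AbramovichTemkinWlodarczyk2024, §5] -/
theorem kinds_match_partS (r : ℚ) (h1 : 1/39 < r) (h2 : r < 1/36) :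
    Kind.N1.wt r = (5/24 - r) + 1 * r ∧ Kind.Np1.wt r = (2/9 - r) + 1 * r ∧
      Kind.W2.wt r = (1/4 - 2 * r) + 2 * r ∧ Kind.V2.wt r = 1/4 + (1/4 - 2 * r) + 2 * r ∧
      Kind.V3.wt r = 2/9 + (5/18 - 3 * r) + 3 * r ∧
      (∀ x : ℚ, Kind.V4.wt r = x + (1/2 - 4 * r - x) + 4 * r) ∧
      Kind.V4N.wt r = 5/24 + (7/24 - 4 * r) + 4 * r ∧ Kind.A1.wt r = 4 * r ∧
      (∀ x : ℚ, Kind.V5.wt r = x + (1/2 - 5 * r - x) + 5 * r) ∧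
      Kind.M5.wt r = (1/3 - 5 * r) + 5 * r ∧
      (Kind.N1.ExistsAt r ↔ TWt r (5/24 - r)) ∧ (Kind.Np1.ExistsAt r ∧ TWt r (2/9 - r)) ∧
      (Kind.W2.ExistsAt r ∧ TWt r (1/4 - 2 * r)) ∧
      (Kind.V2.ExistsAt r ∧ TWt r (1/4) ∧ TWt r (1/4 - 2 * r)) ∧
      (Kind.V3.ExistsAt r ↔ TWt r (2/9) ∧ TWt r (5/18 - 3 * r)) ∧
      (Kind.V4.ExistsAt r ∧ ∃ x y, Dense r x ∧ Dense r y ∧ x + y = 1/2 - 4 * r) ∧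
      (Kind.V4N.ExistsAt r ↔ TWt r (5/24) ∧ TWt r (7/24 - 4 * r)) ∧
      (Kind.V5.ExistsAt r ↔ ∃ x y, Dense r x ∧ Dense r y ∧ x + y = 1/2 - 5 * r) ∧
      (Kind.M5.ExistsAt r ↔ TWt r (1/3 - 5 * r)) := by
  have hN : TWt r (5/24) := Or.inr (by rw [mem_U]; norm_num)
  have hNp : TWt r (2/9) := Or.inr (by rw [mem_U]; norm_num)
  have hW : TWt r (1/4) := Or.inr (by rw [mem_U]; norm_num)
  refine ⟨by simp only [Kind.wt, Kind.w0, Kind.w1]; ring,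
    by simp only [Kind.wt, Kind.w0, Kind.w1]; ring, by simp only [Kind.wt, Kind.w0, Kind.w1]; ring,
    by simp only [Kind.wt, Kind.w0, Kind.w1]; ring, by simp only [Kind.wt, Kind.w0, Kind.w1]; ring,
    fun x => by simp only [Kind.wt, Kind.w0, Kind.w1]; ring,
    by simp only [Kind.wt, Kind.w0, Kind.w1]; ring, by simp only [Kind.wt, Kind.w0, Kind.w1]; ring,
    fun x => by simp only [Kind.wt, Kind.w0, Kind.w1]; ring,
    by simp only [Kind.wt, Kind.w0, Kind.w1]; ring, ?_, ⟨trivial, tWt_x1 h1 h2⟩,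
    ⟨trivial, tWt_x3 h1 h2⟩, ⟨trivial, hW, tWt_x3 h1 h2⟩, ?_, ⟨trivial, exists_V4 h1 h2⟩, ?_, ?_,
    ?_⟩
  · exact (tWt_x2_iff h1 h2).symm
  · show (7/270 : ℚ) ≤ r ↔ _
    rw [tWt_x4_iff h1 h2]; exact ⟨fun h => ⟨hNp, h⟩, fun h => h.2⟩
  · show r ≤ 7/264 ↔ _
    rw [tWt_x5_iff h1 h2]; exact ⟨fun h => ⟨hN, h⟩, fun h => h.2⟩
  · exact (exists_V5_iff h1).symm
  · exact (tWt_x6_iff h1 h2).symm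

/-- Multisets over a list of kinds with total ORDER exactly `b`, each once, as index-nondecreasing
lists (`itertools.combinations_with_replacement` filtered by order sum; first argument = recursion
fuel, any value `≥ b` suffices since every order is `≥ 1`).
[cite: AbramovichTemkinWlodarczyk2024, §5] -/
def msetsO : ℕ → ℕ → List Kind → List (List Kind)
  | _, 0, _ => [[]]
  | 0, _ + 1, _ => []
  | n + 1, b + 1, ks => ks.tails.flatMap fun tl =>
      match tl with
      | [] => []
      | k :: _ => if k.s ≤ b + 1 then (msetsO n (b + 1 - k.s) tl).map (k :: ·) else []

/-- Total order in `σ` of a multiset of members. [cite: AbramovichTemkinWlodarczyk2024, §5] -/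
def ordSum (A : List Kind) : ℕ := (A.map Kind.s).sum

/-- Sum of the constant parts of the member weights. [cite: AbramovichTemkinWlodarczyk2024, §5] -/
def w0Sum (A : List Kind) : ℚ := (A.map Kind.w0).sum

/-- Sum of the `r`-coefficients of the member weights (`= 4 ·` number of `a₁`'s).
[cite: AbramovichTemkinWlodarczyk2024, §5] -/
def w1Sum (A : List Kind) : ℚ := (A.map Kind.w1).sum

/-- The KEPT weight of a multiset of members at degree `r`: `1 − Σ` member weights (the weight
left for the kept `T`-variables of a value-`1` monomial). [cite: AbramovichTemkinWlodarczyk2024, §5] -/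
def kept (A : List Kind) (r : ℚ) : ℚ := 1 - (A.map fun k => k.wt r).sum

/-- `kept A r = 1 − w0Sum A − w1Sum A · r`. [cite: AbramovichTemkinWlodarczyk2024, §5] -/
theorem kept_eq (A : List Kind) (r : ℚ) : kept A r = 1 - w0Sum A - w1Sum A * r := by
  unfold kept w0Sum w1Sum
  induction A with
  | nil => simp
  | cons k A ih =>
    simp only [List.map_cons, List.sum_cons, Kind.wt] at ih ⊢
    linear_combination ih

/-- The CANDIDATE sets: multisets of members with orders summing to `p = 7` and at least one
impure member (all of them: `a₁` alone cannot reach order sum `7`).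
[cite: AbramovichTemkinWlodarczyk2024, §5] -/
def candidates : List (List Kind) := (msetsO 7 7 allKinds).filter fun A => A.any Kind.impure

/-- There are `93` candidate sets. [cite: AbramovichTemkinWlodarczyk2024, §5] -/
theorem candidates_length : candidates.length = 93 := by decide +kernel

/-- Every candidate has order sum `7`, an impure member, at least two members, and at most one
`a₁`. [cite: AbramovichTemkinWlodarczyk2024, §5] -/
theorem candidates_sound : ∀ A ∈ candidates,
    ordSum A = 7 ∧ A.any Kind.impure = true ∧ 2 ≤ A.length ∧ A.count .A1 ≤ 1 := by
  decide +kernel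

/-- The two-member candidates are exactly the seven pairs with orders `{2,5}`, `{3,4}`
(sanity check of the enumeration against the hand list). [cite: AbramovichTemkinWlodarczyk2024, §5] -/
theorem candidates_pairs : candidates.filter (fun A => A.length == 2) =
    [[.W2, .V5], [.W2, .M5], [.V2, .V5], [.V2, .M5], [.V3, .V4], [.V3, .V4N], [.V3, .A1]] := by
  decide +kernel

/-- The ELEVEN active sets of §5.2 (union over the 13 cells; `fdense36.log`), with kept
`T`-variables: `{W(2;x₃), V(5;xx')}·W`, `{W(2;x₃), M(5;x₆)}·NN / ·N'x`, `{V(2;Wx₃), V(5;xx')}`,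
`{V(3;N'x₄), V(4;xx')}`, `{V(3;N'x₄), V(4;Nx₅)}`, `{V(3;N'x₄), a₁}·xx' / ·Nx'`,
`{N(1;x₂), W(2;x₃), a₁}·Wx'`, `{N(1;x₂), V(2;Wx₃), a₁}·x'`, `{N'(1;x₁), N'(1;x₁), M(5;x₆)}·N'`,
`{N'(1;x₁), W(2;x₃), a₁}·N'x` (only for `r ≥ 19/720`), `{W(2;x₃), W(2;x₃), V(3;N'x₄)}`.
[cite: AbramovichTemkinWlodarczyk2024, §5] -/
def active11 : List (List Kind) :=
  [[.W2, .V5], [.W2, .M5], [.V2, .V5], [.V3, .V4], [.V3, .V4N], [.V3, .A1], [.N1, .W2, .A1],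
   [.N1, .V2, .A1], [.Np1, .Np1, .M5], [.Np1, .W2, .A1], [.W2, .W2, .V3]]

/-- The active sets are candidates. [cite: AbramovichTemkinWlodarczyk2024, §5] -/
theorem active11_subset : ∀ A ∈ active11, A ∈ candidates := by decide +kernel

/-- **The kept-weight table** (`r`-free): every candidate is active, or its kept weight
`1 − w0Sum − w1Sum · r` falls in one of the non-representable classes: negative (`w0Sum > 1`,
no `a₁`); in `(0, 1/6] ⊂ (0, 7r)`; `= 17/72` (`{N, N', M(5;·)}`); `= c − 4r` with
`c ∈ {5/18, 3/8, 13/36, 25/72, 1/3}` (one `a₁`); or the set is `{N, N, M(5;·)}` (kept `1/4 = W`,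
but `N(1;x₂)` needs `r ≤ 5/192` and `M(5;x₆)` needs `r ≥ 2/75`).
[cite: AbramovichTemkinWlodarczyk2024, §5] -/
theorem kept_table : ∀ A ∈ candidates,
    A ∈ active11 ∨
    (A ∉ active11 ∧ w1Sum A = 0 ∧ 1 < w0Sum A) ∨
    (A ∉ active11 ∧ w1Sum A = 0 ∧ 5/6 ≤ w0Sum A ∧ w0Sum A < 1) ∨
    (A ∉ active11 ∧ w1Sum A = 0 ∧ w0Sum A = 55/72) ∨
    (A ∉ active11 ∧ w1Sum A = 4 ∧ (w0Sum A = 13/18 ∨ w0Sum A = 5/8 ∨ w0Sum A = 23/36 ∨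
      w0Sum A = 47/72 ∨ w0Sum A = 2/3)) ∨
    (A ∉ active11 ∧ A = [.N1, .N1, .M5]) := by
  decide +kernel

/-- `1/4 = W`, `2/9 = N'`, `5/12 = N + N`, `0` are representable at every degree.
[cite: AbramovichTemkinWlodarczyk2024, §5] -/
theorem repr_consts (r : ℚ) : Representable r (1/4) ∧ Representable r (2/9) ∧
    Representable r (5/12) ∧ Representable r 0 := by
  have hN : Representable r (5/24) := repr_of_tWt (Or.inr (by rw [mem_U]; norm_num))
  refine ⟨repr_of_tWt (Or.inr (by rw [mem_U]; norm_num)),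
    repr_of_tWt (Or.inr (by rw [mem_U]; norm_num)), ?_, repr_zero r⟩
  have := hN.add hN; norm_num at this; exact this

/-- `19/36 − 4r` (kept by `{N'(1;x₁), W(2;x₃), a₁}`) is representable iff `19/720 ≤ r`
(`= N' + (11/36 − 4r)`; below `19/720` no one- or two-part splitting is legal).
[cite: AbramovichTemkinWlodarczyk2024, §5] -/
theorem repr_keptNpW_iff {r : ℚ} (h1 : 1/39 < r) (h2 : r < 1/36) :
    Representable r (19/36 - 4 * r) ↔ 19/720 ≤ r := by
  constructor
  · intro h
    rcases le_or_gt (19/720 : ℚ) r with hle | hlt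
    · exact hle
    exfalso
    rcases repr_cases_of_lt h1 h2 (by linarith) h with h0 | hT | ⟨a, b, ha, hb, hab⟩
    · linarith
    · rcases tWt_cases hT with ⟨-, h⟩ | h | h | h | h | h <;> linarith
    · have ha7 := seven_mul_le_of_tWt h2 ha
      have hb7 := seven_mul_le_of_tWt h2 hb
      rcases tWt_cases ha with ⟨ha1, ha2⟩ | rfl | rfl | rfl | rfl | rfl <;>
        rcases tWt_cases hb with ⟨hb1, hb2⟩ | rfl | rfl | rfl | rfl | rfl <;> linarith
  · intro h
    have := (repr_of_tWt (r := r) (q := 2/9) (Or.inr (by rw [mem_U]; norm_num))).add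
      (repr_of_tWt ((tWt_keptNpW_iff h1 h2).2 h))
    convert this using 1; ring

/-- **PART A: the active sets (symbolic census).** Let `1/39 < r < 1/36`, `A` a candidate all of
whose members exist at `r`.  Then the kept weight of `A` is representable by `T`-parts iff `A`
is one of the eleven active sets — where `{N'(1;x₁), W(2;x₃), a₁}` additionally needs
`r ≥ 19/720`. [cite: AbramovichTemkinWlodarczyk2024, §5] -/
theorem active_census {r : ℚ} (h1 : 1/39 < r) (h2 : r < 1/36) (A : List Kind)
    (hA : A ∈ candidates) (hex : ∀ k ∈ A, k.ExistsAt r) :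
    Representable r (kept A r) ↔ A ∈ active11 ∧ (A = [.Np1, .W2, .A1] → 19/720 ≤ r) := by
  obtain ⟨hW, hNp, hNN, h0⟩ := repr_consts r
  rw [kept_eq]
  rcases kept_table A hA with hmem | ⟨hmem, hw1, hw0⟩ | ⟨hmem, hw1, hw0, hw0'⟩ |
      ⟨hmem, hw1, hw0⟩ | ⟨hmem, hw1, hw0⟩ | ⟨hmem, rfl⟩
  -- the eleven active sets
  · refine ⟨fun hR => ⟨hmem, fun hA' => ?_⟩, fun ⟨_, himp⟩ => ?_⟩
    · subst hA'
      have e : 1 - w0Sum [Kind.Np1, Kind.W2, Kind.A1] - w1Sum [Kind.Np1, Kind.W2, Kind.A1] * r =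
          19/36 - 4 * r := by
        simp only [w0Sum, w1Sum, Kind.w0, Kind.w1, List.map_cons, List.map_nil, List.sum_cons,
          List.sum_nil]; ring
      rw [e] at hR
      exact (repr_keptNpW_iff h1 h2).1 hR
    · simp only [active11, List.mem_cons, List.not_mem_nil, or_false] at hmem
      rcases hmem with rfl | rfl | rfl | rfl | rfl | rfl | rfl | rfl | rfl | rfl | rfl <;>
        simp only [w0Sum, w1Sum, Kind.w0, Kind.w1, List.map_cons, List.map_nil, List.sum_cons,
          List.sum_nil]
      · convert hW using 1; ring
      · convert hNN using 1; ring
      · convert h0 using 1; ring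
      · convert h0 using 1; ring
      · convert h0 using 1; ring
      · have := (repr_of_tWt (tWt_x3 h1 h2)).add (repr_of_tWt (tWt_x3 h1 h2))
        convert this using 1; ring
      · have hx5 : TWt r (7/24 - 4 * r) := (tWt_x5_iff h1 h2).2
          (by have h := hex .N1 (by simp); change r ≤ 5/192 at h; linarith)
        have := hW.add (repr_of_tWt hx5)
        convert this using 1; ring
      · have hx5 : TWt r (7/24 - 4 * r) := (tWt_x5_iff h1 h2).2
          (by have h := hex .N1 (by simp); change r ≤ 5/192 at h; linarith)
        convert repr_of_tWt hx5 using 1; ring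
      · convert hNp using 1; ring
      · have := (repr_keptNpW_iff h1 h2).2 (himp rfl)
        convert this using 1; ring
      · convert h0 using 1; ring
  -- kept weight negative
  · refine iff_of_false ?_ (fun h => hmem h.1)
    rw [hw1]; exact not_repr_of_neg h1 h2 (by linarith)
  -- kept weight in `(0, 1/6]`
  · refine iff_of_false ?_ (fun h => hmem h.1)
    rw [hw1]; exact not_repr_of_pos_of_lt h1 h2 (by linarith) (by linarith)
  -- kept weight `17/72`
  · refine iff_of_false ?_ (fun h => hmem h.1)
    rw [hw1, hw0]
    exact not_repr_of_gap h1 h2 (by norm_num) (by linarith) (by rw [mem_U]; norm_num)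
  -- one `a₁`: kept weight `c − 4r`
  · refine iff_of_false ?_ (fun h => hmem h.1)
    rw [hw1]
    rcases hw0 with hw0 | hw0 | hw0 | hw0 | hw0 <;> rw [hw0]
    · exact not_repr_of_pos_of_lt h1 h2 (by linarith) (by linarith)
    all_goals
      refine not_repr_of_gap h1 h2 (by linarith) (by linarith) ?_
      rw [mem_U]; rintro (h | h | h | h | h) <;> linarith
  -- `{N, N, M(5;·)}`: the members never coexist
  · exfalso
    have hN1 := hex .N1 (by simp)
    have hM5 := hex .M5 (by simp)
    change r ≤ 5/192 at hN1
    change (2/75 : ℚ) ≤ r at hM5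
    linarith

/-- **FACT A on the interval.** Every active set contains a KILLED kind: `W(2;x₃)` or its
companion `V(2;W x₃)` (first kill), else `N'(1;x₁)`, else `V(3;N' x₄)`.
[cite: AbramovichTemkinWlodarczyk2024, §5] -/
theorem factA : ∀ A ∈ active11, ∃ k ∈ A, k.killed = true := by decide

/-- The kill assignment of §5.2 / `fdense36.log`, set by set. [cite: AbramovichTemkinWlodarczyk2024, §5] -/
theorem factA_assignment : ∀ A ∈ active11,
    (Kind.W2 ∈ A ∨ Kind.V2 ∈ A) ∨ (Kind.Np1 ∈ A ∧ Kind.W2 ∉ A ∧ Kind.V2 ∉ A) ∨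
      (Kind.V3 ∈ A ∧ Kind.W2 ∉ A ∧ Kind.V2 ∉ A ∧ Kind.Np1 ∉ A) := by
  decide

/-! ## PART K: block legality for the kill readings

A source of the reading `[σ^s · ε_x · μ]` is a splitting of the atoms `{x} ∪ μ` into blocks,
each carried by one emitter of some order, the orders summing to `s`; an emitter carrying block
`B` at order `a` sits in a slot of weight `wt B + a r`, which must be legal.  The lemmas below
decide legality of every (block, order) pair; "MAIN" = the block `{x}` at full order, "COMPANION"
= the block `{x, w'}` (slot `V`). -/

/-- `Legal`, unfolded. [cite: AbramovichTemkinWlodarczyk2024, §5] -/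
theorem legal_iff {w : ℚ} :
    Legal w ↔ (0 < w ∧ w ≤ 1/5) ∨ w = 5/24 ∨ w = 2/9 ∨ w = 1/4 ∨ w = 1/3 ∨ w = 1/2 := by
  unfold Legal; rw [mem_U]

/-- **`W(2;x₃)` reading `[σ² · ε_{x₃} · μ]`, `μ ∈ {VW, WWW}`.** Atoms: `x₃ = 1/4 − 2r`
(multiplicity `i ≤ 1`), `V = 1/2` (`j ≤ 1`), `W = 1/4` (`k ≤ 3`); emitter order `a ∈ {1, 2}`.
The block is legal iff `a = 2` and it is `{x₃}` (slot `W`: MAIN) or `{x₃, W}` (slot `V`: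
COMPANION).  In particular no order-`1` block is legal (two order-`1` emitters never occur:
`1/4 − r`, `1/4 + r`, … are illegal). [cite: AbramovichTemkinWlodarczyk2024, §5] -/
theorem W2_blocks {r : ℚ} (h1 : 1/39 < r) (h2 : r < 1/36) (i j k a : ℕ) (hi : i ≤ 1)
    (hj : j ≤ 1) (hk : k ≤ 3) (hne : 1 ≤ i + j + k) (ha1 : 1 ≤ a) (ha2 : a ≤ 2) :
    Legal (i * (1/4 - 2 * r) + j * (1/2 : ℚ) + k * (1/4 : ℚ) + a * r) ↔
      a = 2 ∧ i = 1 ∧ j = 0 ∧ k ≤ 1 := by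
  interval_cases i <;> interval_cases j <;> interval_cases k <;> interval_cases a
  all_goals
    first
    | (exfalso; omega)
    | (rw [legal_iff]
       constructor
       · rintro (⟨h', h''⟩ | h' | h' | h' | h' | h') <;>
           first | decide | (exfalso; (try push_cast at *); linarith)
       · intro hP
         first
         | exact absurd hP (by decide)
         | (push_cast; ring_nf; try norm_num))

/-- **`N'(1;x₁)` reading `[σ · ε_{x₁} · ε_m ε_{u'} ε_{u''}]` (`μ = M N' N'`, the structure of
`N'`).** Atoms: `x₁ = 2/9 − r` (`i ≤ 1`), `M = 1/3` (`j ≤ 1`), `N' = 2/9` (`k ≤ 2`); the single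
emitter has order `1`.  The block is legal iff it is `{x₁}` (slot `N'`: MAIN only; `2/9 + r`,
`1/3 + r`, `4/9`, … are illegal — the polluter `W(1;N')` of the point `1/36`, `2/9 + 1/36 = 1/4`,
is absent on the open interval). [cite: AbramovichTemkinWlodarczyk2024, §5] -/
theorem Np1_blocks {r : ℚ} (h1 : 1/39 < r) (h2 : r < 1/36) (i j k : ℕ) (hi : i ≤ 1)
    (hj : j ≤ 1) (hk : k ≤ 2) (hne : 1 ≤ i + j + k) :
    Legal (i * (2/9 - r) + j * (1/3 : ℚ) + k * (2/9 : ℚ) + r) ↔ i = 1 ∧ j = 0 ∧ k = 0 := by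
  interval_cases i <;> interval_cases j <;> interval_cases k
  all_goals
    first
    | (exfalso; omega)
    | (rw [legal_iff]
       constructor
       · rintro (⟨h', h''⟩ | h' | h' | h' | h' | h') <;>
           first | decide | (exfalso; (try push_cast at *); linarith)
       · intro hP
         first
         | exact absurd hP (by decide)
         | (push_cast; ring_nf; try norm_num))

/-- **`V(3;N' x₄)` reading `[σ³ · ε_{u'} ε_{x₄} · ε_{v'}]` (`μ = V`).** Atoms: `N' = 2/9`
(`i ≤ 1`), `x₄ = 5/18 − 3r` (`j ≤ 1`), `V = 1/2` (`k ≤ 1`); emitter order `a ∈ {1, 2, 3}`.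
The block is legal iff `a = 3` and it is `{N', x₄}` (slot `V`: MAIN only; `5/18 − 2r`,
`5/18 − r`, `5/18`, `2/9 + a r` are illegal). [cite: AbramovichTemkinWlodarczyk2024, §5] -/
theorem V3_blocks {r : ℚ} (h1 : 1/39 < r) (h2 : r < 1/36) (i j k a : ℕ) (hi : i ≤ 1)
    (hj : j ≤ 1) (hk : k ≤ 1) (hne : 1 ≤ i + j + k) (ha1 : 1 ≤ a) (ha3 : a ≤ 3) :
    Legal (i * (2/9 : ℚ) + j * (5/18 - 3 * r) + k * (1/2 : ℚ) + a * r) ↔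
      a = 3 ∧ i = 1 ∧ j = 1 ∧ k = 0 := by
  interval_cases i <;> interval_cases j <;> interval_cases k <;> interval_cases a
  all_goals
    first
    | (exfalso; omega)
    | (rw [legal_iff]
       constructor
       · rintro (⟨h', h''⟩ | h' | h' | h' | h' | h') <;>
           first | decide | (exfalso; (try push_cast at *); linarith)
       · intro hP
         first
         | exact absurd hP (by decide)
         | (push_cast; ring_nf; try norm_num))

/-- **`N(1;x₂)` reading `[σ · ε_{x₂} · ε_m ε_n ε_w]` (`μ = M N W`, the structure of `N`; for
information, `r ≤ 5/192`).** Atoms: `x₂ = 5/24 − r` (`i ≤ 1`), `M = 1/3` (`j ≤ 1`), `N = 5/24`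
(`k ≤ 1`), `W = 1/4` (`l ≤ 1`); order `1`.  Legal iff the block is `{x₂}` (MAIN only).
[cite: AbramovichTemkinWlodarczyk2024, §5] -/
theorem N1_blocks {r : ℚ} (h1 : 1/39 < r) (h2 : r < 1/36) (i j k l : ℕ) (hi : i ≤ 1)
    (hj : j ≤ 1) (hk : k ≤ 1) (hl : l ≤ 1) (hne : 1 ≤ i + j + k + l) :
    Legal (i * (5/24 - r) + j * (1/3 : ℚ) + k * (5/24 : ℚ) + l * (1/4 : ℚ) + r) ↔
      i = 1 ∧ j = 0 ∧ k = 0 ∧ l = 0 := by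
  interval_cases i <;> interval_cases j <;> interval_cases k <;> interval_cases l
  all_goals
    first
    | (exfalso; omega)
    | (rw [legal_iff]
       constructor
       · rintro (⟨h', h''⟩ | h' | h' | h' | h' | h') <;>
           first | decide | (exfalso; (try push_cast at *); linarith)
       · intro hP
         first
         | exact absurd hP (by decide)
         | (push_cast; ring_nf; try norm_num))

/-- **Kill-reading side facts** (CARVER-NOTES T37 (iii), the named illegal weights): `1/4 ± r`
(no two order-`1` emitters in the `W(2;x₃)` reading); `2/9 + a r ∉ U` for `a = 1, 2, 3`,
`1/3 + r` and `4/9` illegal (the `N'(1;x₁)` reading is MAIN only); `5/18 − 2r`, `5/18 − r`,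
`5/18` illegal (the `V(3;N' x₄)` reading is MAIN only); and at the excluded endpoint `r = 1/36`
the polluter reappears: `2/9 + 1/36 = 1/4`. [cite: AbramovichTemkinWlodarczyk2024, §5] -/
theorem kill_side_facts {r : ℚ} (h1 : 1/39 < r) (h2 : r < 1/36) :
    ¬ Legal (1/4 - r) ∧ ¬ Legal (1/4 + r) ∧ 2/9 + r ∉ U ∧ 2/9 + 2 * r ∉ U ∧ 2/9 + 3 * r ∉ U ∧
      ¬ Legal (1/3 + r) ∧ ¬ Legal (4/9) ∧ ¬ Legal (5/18 - 2 * r) ∧ ¬ Legal (5/18 - r) ∧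
      ¬ Legal (5/18) ∧ (2/9 + 1/36 : ℚ) = 1/4 := by
  refine ⟨?_, ?_, ?_, ?_, ?_, ?_, ?_, ?_, ?_, ?_, by norm_num⟩
  all_goals
    first
    | (rw [legal_iff]; rintro (⟨h', h''⟩ | h' | h' | h' | h' | h') <;> linarith)
    | (rw [mem_U]; rintro (h' | h' | h' | h' | h') <;> linarith)

end Interval39

end Literature.AlgebraicGeometry.Resolution.WeightedBlowup
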